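import Mathlib
import Literature.NumberTheory.QuadraticFields.BinaryQuadraticFormsClassNumber
-- NOTE: the route module `Summits.ABC.ABC.Theses.RibetTakahashiSplit` is deliberately NOT imported:
-- the farm's copy predates item stmt-ABC-15197 (crux write answered `remote:incoherent`); the crux
-- body is restated below as `CruxShape`, verbatim.

/-!
# Sketch — crux-ideate stmt-ABC-15197 `FewPrimeHardCore` (round 1, ideator 2)

First lemmas (as `Prop`s over existing declarations; nothing is proved here) for the crux ideas

* `class-order-quantization` — definite quadratic descent of the hard core: power-coincidence
  clearing (A1/A2), the Gaussian cell (B), Le's least-exponent divisibility and its class-number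
  bound (M1/M2), the Bilu–Hanrot–Voutier quantisation on the main cell (M3), the transfer target
  `ClassOrderBound` (T) and the unconditional LFL-free dividend (D);
* `one-exact-edge` — its elementary hinge is (A2)/(A1) (the modular identity itself is informal:
  no Shimura-curve degree `δ_{D,M}` exists in the tree).

Pattern 2 (`p^x + 2^k r^z = q^y`, isolated member `q^y`) is displayed; patterns 1 (k ≤ 2) and 3
are the same statements with the roles of the members permuted.
-/

set_option linter.dupNamespace false

noncomputable section

namespace Summit.ABC.ABC.Cruxes.FewPrimeHardCore.Sketch

open Literature.NumberTheory.QuadraticFields.Quadratic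

/-- The crux's hypothesis shape, abbreviated. -/
def IsHardCore (p q r x y z k : ℕ) : Prop :=
  p.Prime ∧ q.Prime ∧ r.Prime ∧ Odd p ∧ Odd q ∧ Odd r ∧ p ≠ q ∧ p ≠ r ∧ q ≠ r ∧
    0 < x ∧ 0 < y ∧ 0 < z ∧ 0 < k ∧
    (p ^ x + q ^ y = 2 ^ k * r ^ z ∨ p ^ x + 2 ^ k * r ^ z = q ^ y ∨ q ^ y + 2 ^ k * r ^ z = p ^ x)

/-- **(A1) Difference of two squares ⇒ face** (pattern 3 with `x = 2a`, `y = 2b`): the two factors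
`p^a ∓ q^b` have gcd exactly `2`, so one of them is a pure power of two — a FACE relation
`p^a = q^b + 2^j` or `p^a + q^b = 2^j`, whose exponents the landed face theorem bounds by
`polylog(2pq)`. Provable now (elementary). -/
def DiffSquaresToFace : Prop :=
  ∀ p q r a b z k : ℕ, p.Prime → q.Prime → r.Prime → Odd p → Odd q → Odd r →
    p ≠ q → p ≠ r → q ≠ r → 0 < a → 0 < b → 0 < z → 0 < k →
    q ^ (2 * b) + 2 ^ k * r ^ z = p ^ (2 * a) →
    ∃ j : ℕ, 0 < j ∧ j < k ∧
      ((p ^ a = q ^ b + 2 ^ j ∧ p ^ a + q ^ b = 2 ^ (k - j) * r ^ z) ∨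
       (p ^ a + q ^ b = 2 ^ j ∧ p ^ a = q ^ b + 2 ^ (k - j) * r ^ z))

/-- **(A2) Odd common exponent ⇒ face** (pattern 1; patterns 2/3 alike with `−`): if an odd prime
`ℓ` divides both exponents of the two pure members, `U^ℓ + V^ℓ = (U + V)·Φ_ℓ(U,V)` with `Φ_ℓ` odd,
`gcd(U + V, Φ_ℓ) ∣ ℓ` and `Φ_ℓ > ℓ`, whence `U + V = 2^k` (a FACE) and `Φ_ℓ(U, V) = r^z`.
Provable now (elementary, Zsigmondy-free). -/
def OddCommonExponentToFace : Prop :=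
  ∀ p q r ℓ u v z k : ℕ, p.Prime → q.Prime → r.Prime → Odd p → Odd q → Odd r →
    p ≠ q → p ≠ r → q ≠ r → ℓ.Prime → Odd ℓ → 0 < u → 0 < v → 0 < z → 0 < k →
    p ^ (ℓ * u) + q ^ (ℓ * v) = 2 ^ k * r ^ z →
    p ^ u + q ^ v = 2 ^ k ∧ p ^ (ℓ * u) + q ^ (ℓ * v) = (p ^ u + q ^ v) * r ^ z

/-- **(B) Gaussian cell, odd `z`**: `p^{2a} + q^{2b} = 2^k r^z` forces `k = 1` (sum of two odd
coprime squares is `2 mod 8`) and, in `ℤ[i]`/`ℤ[ζ₈]`, the solution is the `z`-th power of the least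
solution of `X² + Y² = 2r` (Le; class number one); one coordinate is a pure prime power dividing
`(α² − β²)²`, so the Lehmer number `ũ_z` or `ũ_{2z}` has no primitive divisor and
Bilu–Hanrot–Voutier gives `z ≤ 30`. (Even `z` is the Pythagorean sub-cell, treated in the card.) -/
def GaussianOddCell : Prop :=
  ∀ p q r a b z k : ℕ, p.Prime → q.Prime → r.Prime → Odd p → Odd q → Odd r →
    p ≠ q → p ≠ r → q ≠ r → 0 < a → 0 < b → Odd z → 0 < k →
    p ^ (2 * a) + q ^ (2 * b) = 2 ^ k * r ^ z → k = 1 ∧ z ≤ 30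

/-- The least exponent `Z ≥ 1` for which `Q^Z` is primitively represented by the definite form
`D₁ X² + D₂ W²` (`0` if there is none; `sInf ∅ = 0` in `ℕ`). [Le 1995; Bugeaud–Shorey 2001, §2] -/
def leastRepExp (D₁ D₂ Q : ℕ) : ℕ :=
  sInf {Z : ℕ | 0 < Z ∧ ∃ X W : ℕ, Nat.Coprime (D₁ * X) (D₂ * W) ∧ D₁ * X ^ 2 + D₂ * W ^ 2 = Q ^ Z}

/-- The definite descent of pattern 2: coefficients `D₁ = p^{x mod 2}`, `D₂ = 2^{k mod 2} r^{z mod 2}`,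
isolated prime `Q = q`. -/
def descD₁ (p x : ℕ) : ℕ := p ^ (x % 2)

/-- See `descD₁`. -/
def descD₂ (r z k : ℕ) : ℕ := 2 ^ (k % 2) * r ^ (z % 2)

/-- **(M1) Le's divisibility** (pattern 2): the isolated exponent `y` is a multiple of the least
representation exponent `Z₁ = leastRepExp D₁ D₂ q` — all solutions of `D₁X² + D₂W² = q^Z` with
`q` prime form ONE class generated by the least one. [Le 1995, Thm; Bugeaud–Shorey 2001, Lemma 1] -/
def LeDivisibility : Prop :=
  ∀ p q r x y z k : ℕ, p.Prime → q.Prime → r.Prime → Odd p → Odd q → Odd r →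
    p ≠ q → p ≠ r → q ≠ r → 0 < x → 0 < y → 0 < z → 0 < k →
    p ^ x + 2 ^ k * r ^ z = q ^ y →
    0 < leastRepExp (descD₁ p x) (descD₂ r z k) q ∧ leastRepExp (descD₁ p x) (descD₂ r z k) q ∣ y

/-- **(M2) The least exponent divides (thrice) the form class number `h(−4 D₁ D₂)`**: `Z₁` is the
order of the class `[𝔮]·[⟨D₁,0,D₂⟩]` in the form class group of discriminant `−4D₁D₂` (the factor
`3` absorbs the discriminants `−3, −12` with extra automorphs). [Bugeaud–Shorey 2001, Lemma 2 (from
Le)] — `BinQF.classNumber` is the tree's form class number (Cox Thm 2.8/2.13). -/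
def LeastExpDvdClassNumber : Prop :=
  ∀ D₁ D₂ Q : ℕ, 0 < D₁ → 0 < D₂ → Q.Prime → Odd Q → Nat.Coprime Q (D₁ * D₂) →
    0 < leastRepExp D₁ D₂ Q →
    leastRepExp D₁ D₂ Q ∣ 3 * BinQF.classNumber (-(4 * D₁ * D₂ : ℤ))

/-- The EXCEPTIONAL (face-seeded) branch of the main cell, pattern 2: the pure member `p^x` is a
square (`x` even) and the least solution has pure coordinate `1`, i.e. it is the FACE
`1 + D₂·W₁² = q^{Z₁}` (so `q^{Z₁} − 1` is a `{2, r}`-unit: Fermat/Catalan-type `q`). -/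
def FaceSeeded (_p q r x y z k : ℕ) : Prop :=
  Even x ∧ ∃ Z₁ W₁ : ℕ, 0 < Z₁ ∧ Z₁ ∣ y ∧ 1 + descD₂ r z k * W₁ ^ 2 = q ^ Z₁

/-- **(M3) Main-cell quantisation** (pattern 2): `y = Z₁·t` with `t ≤ 30`, unless face-seeded.
Mechanism: `(X√D₁ + W√−D₂) = ±(X₁√D₁ ± W₁√−D₂)^t` (Le), the pure coordinate `X = p^a` equals
`X₁·ũ_t` (or `X₁·ũ_{2t}/ũ_t`) for the Lehmer pair `(α, ᾱ)`, and `p ∣ D₁X₁ ∣ (α² − ᾱ²)²` makes `p`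
non-primitive, so Bilu–Hanrot–Voutier (no Lehmer number `ũ_n`, `n > 30`, lacks a primitive
divisor) gives `t ≤ 30` (resp. `2t ≤ 30`); `p ∤ D₁X₁` is exactly `FaceSeeded`.
[BiluHanrotVoutier2001, Thm 1.4; Le 1995; Bugeaud–Shorey 2001] -/
def MainCellQuantization : Prop :=
  ∀ p q r x y z k : ℕ, p.Prime → q.Prime → r.Prime → Odd p → Odd q → Odd r →
    p ≠ q → p ≠ r → q ≠ r → 0 < x → 0 < y → 0 < z → 0 < k →
    p ^ x + 2 ^ k * r ^ z = q ^ y →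
    (∃ t : ℕ, t ≤ 30 ∧ y = leastRepExp (descD₁ p x) (descD₂ r z k) q * t) ∨ FaceSeeded p q r x y z k

/-- **(T) Transfer target `C⁺` on the main cell (pattern 2): CLASS-ORDER BOUND.** The order `Z₁` of
the class of `q` (times the ambiguous class of `⟨D₁, 0, D₂⟩`) in the form class group of discriminant
`−4·p^{x mod 2}·2^{k mod 2}·r^{z mod 2}` is `≤ C_ε (2pqr)^ε` whenever the hard-core relation holds
off the face-seeded branch. With (M3), balance (landed LFL) and small-prime clearing (landed) this
is EQUIVALENT to the crux on the main cell; it has no free exponent. -/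
def ClassOrderBound : Prop :=
  ∀ ε : ℝ, 0 < ε → ∃ C : ℝ, ∀ p q r x y z k : ℕ, p.Prime → q.Prime → r.Prime →
    Odd p → Odd q → Odd r → p ≠ q → p ≠ r → q ≠ r → 0 < x → 0 < y → 0 < z → 0 < k →
    p ^ x + 2 ^ k * r ^ z = q ^ y → ¬ FaceSeeded p q r x y z k →
    (leastRepExp (descD₁ p x) (descD₂ r z k) q : ℝ) ≤ C * ((2 * p * q * r : ℕ) : ℝ) ^ ε

/-- **(D) Unconditional, LFL-free dividend** (pattern 2): off the face-seeded branch the isolated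
exponent satisfies `y ≤ 90·h(−4 D₁ D₂)` (`= 30·3·h`), `D₁D₂ ∣ 2pr` — so
`log c = y log q ≪ √(pr)·log(pr)·log q`: a Stewart–Yu-shape bound `≍ R^{1/3}` at the balanced point,
from class groups + primitive divisors alone. -/
def ClassNumberBoundPattern2 : Prop :=
  ∀ p q r x y z k : ℕ, p.Prime → q.Prime → r.Prime → Odd p → Odd q → Odd r →
    p ≠ q → p ≠ r → q ≠ r → 0 < x → 0 < y → 0 < z → 0 < k →
    p ^ x + 2 ^ k * r ^ z = q ^ y → ¬ FaceSeeded p q r x y z k →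
    y ≤ 90 * BinQF.classNumber (-(4 * descD₁ p x * descD₂ r z k : ℤ))

/-- The crux VERBATIM (body of `Summit.ABC.ABC.Theses.RibetTakahashiSplit.FewPrimeHardCore`,
route file rev of 2026-08-16T13:15Z; restated here only because the farm's copy of the route module
predates the item — the cards conclude the route decl by name, no skeleton at this stage). -/
def CruxShape : Prop :=
  ∀ ε : ℝ, 0 < ε → ∃ C : ℝ, ∀ p q r x y z k : ℕ, p.Prime → q.Prime → r.Prime → Odd p → Odd q →
    Odd r → p ≠ q → p ≠ r → q ≠ r → 0 < x → 0 < y → 0 < z → 0 < k →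
    (p ^ x + q ^ y = 2 ^ k * r ^ z ∨ p ^ x + 2 ^ k * r ^ z = q ^ y ∨ q ^ y + 2 ^ k * r ^ z = p ^ x) →
    ((x * y * z * k : ℕ) : ℝ) ≤ C * ((2 * p * q * r : ℕ) : ℝ) ^ ε

/-- Sanity instance of the hard-core shape: `3³ + 2·7² = 5³` (pattern 2; `gcd(x,y) = 3`, and indeed
`5 − 3 = 2` is the face and `Φ₃(5,3) = 49 = 7²`, as (A2) predicts). -/
example : IsHardCore 3 5 7 3 3 2 1 := by
  refine ⟨by norm_num, by norm_num, by norm_num, by decide, by decide, by decide, by decide, by decide,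
    by decide, by decide, by decide, by decide, by decide, ?_⟩
  right; left; norm_num

/-- Sanity instance: `41² + 2²·19² = 5⁵` (pattern 2, face-seeded by `1 + 4 = 5`: `(1 + 2i)⁵ = 41 − 38i`,
`t = 5`), and `7² + 2⁶·3² = 5⁴` (`t = 4`): the exceptional branch of (M3) is not empty. -/
example : IsHardCore 41 5 19 2 5 2 2 ∧ IsHardCore 7 5 3 2 4 2 6 := by
  constructor
  · refine ⟨by norm_num, by norm_num, by norm_num, by decide, by decide, by decide, by decide,
      by decide, by decide, by decide, by decide, by decide, by decide, ?_⟩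
    right; left; norm_num
  · refine ⟨by norm_num, by norm_num, by norm_num, by decide, by decide, by decide, by decide,
      by decide, by decide, by decide, by decide, by decide, by decide, ?_⟩
    right; left; norm_num

/-- Sanity instance of the Gaussian cell: `3⁴ + 13² = 2·5³` (`z = 3 = t`, least solution `1² + 3² = 2·5`,
`ũ₃ = 9/3 = 3` has no primitive divisor) and `31² + 17² = 2·5⁴` (even `z`: Pythagorean sub-cell). -/
example : IsHardCore 3 13 5 4 2 3 1 ∧ IsHardCore 31 17 5 2 2 4 1 := by
  constructor
  · refine ⟨by norm_num, by norm_num, by norm_num, by decide, by decide, by decide, by decide,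
      by decide, by decide, by decide, by decide, by decide, by decide, ?_⟩
    left; norm_num
  · refine ⟨by norm_num, by norm_num, by norm_num, by decide, by decide, by decide, by decide,
      by decide, by decide, by decide, by decide, by decide, by decide, ?_⟩
    left; norm_num

end Summit.ABC.ABC.Cruxes.FewPrimeHardCore.Sketch

end
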